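import Summits.HodgeConjecture.HodgeConjecture.Theorems.CyclicUnitaryPowersSLCommutators

/-!
# Determinant-one automorphisms lie in every commutator-containing subgroup of `GL(E)` (basis-free form)

Helper for stub D₂ `stub_deckUnitaryCommutatorGeneration` of the crux `PowersHodgeOfDeckCommutators`
(stmt-HodgeConjecture-19545, route `CyclicUnitaryPowers`, line `unitary-kunneth-fft` v5, lane 2), step (b3) of
HOME/memos/STUB-PLAN-D2b-Bx.md: the matrix statement `CyclicUnitaryPowersSLCommutators.toGL_mem_of_commutators`
transported to the automorphism group `E ≃ₗ[K] E` of a finite-dimensional vector space through a basis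
(`toGLUnits`, a multiplicative, injective map onto `GL (Fin n) K`), and — for any group homomorphism
`φ : (E ≃ₗ[K] E) →* G` — to the preimage of a subgroup of `G` containing all commutators of the image
(`mem_of_det_eq_one_of_commutators`, `map_mem_of_det_eq_one`).
-/

noncomputable section

open Module Matrix

namespace Summit.HodgeConjecture.HodgeConjecture.Theorems.CyclicUnitaryPowersSLTransfer

open Summit.HodgeConjecture.HodgeConjecture.Theorems.CyclicUnitaryPowersSLCommutators

variable {K : Type*} [Field K] {E : Type*} [AddCommGroup E] [Module K E] [FiniteDimensional K E]

/-- The matrix of an automorphism in the basis `Module.finBasis`, as a unit. [folklore] -/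
def toGLUnits (A : E ≃ₗ[K] E) : GL (Fin (Module.finrank K E)) K :=
  ⟨LinearMap.toMatrix (Module.finBasis K E) (Module.finBasis K E) (A : E →ₗ[K] E),
    LinearMap.toMatrix (Module.finBasis K E) (Module.finBasis K E) (A.symm : E →ₗ[K] E),
    by
      rw [← LinearMap.toMatrix_mul, show (A : E →ₗ[K] E) * (A.symm : E →ₗ[K] E) = 1 from by ext x; simp,
        show (1 : Module.End K E) = LinearMap.id from rfl, LinearMap.toMatrix_id],
    by
      rw [← LinearMap.toMatrix_mul, show (A.symm : E →ₗ[K] E) * (A : E →ₗ[K] E) = 1 from by ext x; simp,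
        show (1 : Module.End K E) = LinearMap.id from rfl, LinearMap.toMatrix_id]⟩

/-- Coercion of `toGLUnits`. [folklore] -/
@[simp] theorem coe_toGLUnits (A : E ≃ₗ[K] E) :
    Units.val (toGLUnits A) = LinearMap.toMatrix (Module.finBasis K E) (Module.finBasis K E) (A : E →ₗ[K] E) := rfl

/-- `toGLUnits` is multiplicative. [folklore] -/
theorem toGLUnits_mul (A B : E ≃ₗ[K] E) : toGLUnits (A * B) = toGLUnits A * toGLUnits B := by
  apply Units.ext
  simp only [coe_toGLUnits, Units.val_mul, LinearEquiv.coe_toLinearMap_mul, LinearMap.toMatrix_mul]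

/-- `toGLUnits` as a monoid homomorphism. [folklore] -/
def toGLUnitsHom : (E ≃ₗ[K] E) →* GL (Fin (Module.finrank K E)) K where
  toFun := toGLUnits
  map_one' := by
    apply Units.ext
    simp only [coe_toGLUnits, Units.val_one, LinearEquiv.coe_toLinearMap_one, LinearMap.toMatrix_id]
  map_mul' := toGLUnits_mul

/-- `toGLUnits` is injective. [folklore] -/
theorem toGLUnits_injective : Function.Injective (toGLUnits (K := K) (E := E)) := by
  intro A B h
  have h' := congrArg Units.val h
  simp only [coe_toGLUnits] at h'
  exact LinearEquiv.toLinearMap_injective ((LinearMap.toMatrix _ _).injective h')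

/-- `toGLUnits` is surjective. [folklore] -/
theorem toGLUnits_surjective : Function.Surjective (toGLUnits (K := K) (E := E)) := by
  intro u
  refine ⟨Matrix.toLinearEquiv (Module.finBasis K E) (u : Matrix _ _ K) (Matrix.isUnits_det_units u), ?_⟩
  apply Units.ext
  rw [coe_toGLUnits]
  change LinearMap.toMatrix _ _ (Matrix.toLin (Module.finBasis K E) (Module.finBasis K E) (u : Matrix _ _ K)) = _
  rw [LinearMap.toMatrix_toLin]

/-- `det` through `toGLUnits`. [folklore] -/
theorem det_coe_toGLUnits (A : E ≃ₗ[K] E) :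
    (Units.val (toGLUnits A)).det = LinearMap.det (A : E →ₗ[K] E) := by
  rw [coe_toGLUnits, LinearMap.det_toMatrix]

/-- **Determinant-one automorphisms lie in every subgroup of `E ≃ₗ[K] E` containing all commutators**
(`(2 : K) ≠ 0`). [folklore] -/
theorem mem_of_det_eq_one_of_commutators (h2 : (2 : K) ≠ 0) (S : Subgroup (E ≃ₗ[K] E))
    (hS : ∀ a b : E ≃ₗ[K] E, a * b * a⁻¹ * b⁻¹ ∈ S) {A : E ≃ₗ[K] E} (hA : LinearMap.det (A : E →ₗ[K] E) = 1) :
    A ∈ S := by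
  -- the image subgroup in `GL (Fin n) K` contains all commutators
  set T : Subgroup (GL (Fin (Module.finrank K E)) K) := S.map toGLUnitsHom with hT
  have hT' : ∀ a b : GL (Fin (Module.finrank K E)) K, a * b * a⁻¹ * b⁻¹ ∈ T := by
    intro a b
    obtain ⟨a', rfl⟩ := toGLUnits_surjective a
    obtain ⟨b', rfl⟩ := toGLUnits_surjective b
    refine ⟨a' * b' * a'⁻¹ * b'⁻¹, hS a' b', ?_⟩
    simp only [map_mul, map_inv]
    rfl
  -- the matrix of `A` is in `SL`
  set M : SpecialLinearGroup (Fin (Module.finrank K E)) K :=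
    ⟨LinearMap.toMatrix (Module.finBasis K E) (Module.finBasis K E) (A : E →ₗ[K] E),
      by rw [LinearMap.det_toMatrix, hA]⟩ with hM
  have hmem := toGL_mem_of_commutators h2 T hT' M
  obtain ⟨A', hA'S, hA'⟩ := hmem
  have heq : toGLUnits A' = toGLUnits A := by
    refine (show toGLUnits A' = SpecialLinearGroup.toGL M from hA').trans ?_
    apply Units.ext
    rfl
  rwa [← toGLUnits_injective heq]

/-- Transport along a homomorphism: if `φ : (E ≃ₗ[K] E) →* G` and `S ≤ G` contains all commutators of elements
of the image of `φ`, then `φ A ∈ S` for every `A` of determinant `1`. [folklore] -/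
theorem map_mem_of_det_eq_one {G : Type*} [Group G] (h2 : (2 : K) ≠ 0) (φ : (E ≃ₗ[K] E) →* G) (S : Subgroup G)
    (hS : ∀ a b : E ≃ₗ[K] E, φ a * φ b * (φ a)⁻¹ * (φ b)⁻¹ ∈ S) {A : E ≃ₗ[K] E}
    (hA : LinearMap.det (A : E →ₗ[K] E) = 1) : φ A ∈ S := by
  have h := mem_of_det_eq_one_of_commutators h2 (S.comap φ)
    (fun a b => by
      show φ (a * b * a⁻¹ * b⁻¹) ∈ S
      rw [map_mul, map_mul, map_mul, map_inv, map_inv]; exact hS a b) hA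
  exact h

end Summit.HodgeConjecture.HodgeConjecture.Theorems.CyclicUnitaryPowersSLTransfer

end
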